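import Mathlib
import HarnessLib
import Summits.Ventures.LatticeQCDFlow.Exactness.SU2FTHMCGaugeCovarianceMembers
import Summits.Ventures.LatticeQCDFlow.Exactness.U1MemberGaugeCovariance
import Literature.Barriers.QuantumFields.ElitzurTheorem

/-!
# The `U(1)` rung: the FT-HMC kernel exactly as the engine runs it commutes with every gauge transformation; the exact force of an invariant action is gauge INVARIANT — no force hypothesis left

HONEST FRAMING: exact (Metropolis-corrected) sampling algorithms for lattice gauge theory;
figures of merit are autocorrelation/cost numbers at stated couplings and volumes; no
continuum-physics claim.

Venture `LatticeQCDFlow` (cell pub-lqcd), topic `Exactness`; FANOUT row 14 (`eng-flowhmc`, engine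
`latflow.fthmc` on the `U(1)` rung: links `GaugeConfig d L U(1)`, momenta `Edge → ℝ` with the
Gaussian law, drift `V_e ← e^{icp_e} V_e`, leapfrog^n with a force routine, flip, Metropolis on
`(S∘F − log J) + Σ p²/2`, forget, report `F V`).  NEW WORK of the cell; nothing is cited as a fact;
no number.  The abelian twin of `SU2FTHMCGaugeCovariance` / `SU2ExactForceCovariance`: under
`V ↦ V^h`, `(V^h)(x, μ) = h_x V(x, μ) h_{x+μ̂}⁻¹`, the momenta of an abelian group do not rotate
(`R = id`), so `FTHMCKernelCovariance.gauge_fthmc_conjKernel_eq_self` applies with the identity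
momentum symmetry:

* `circleDrift_mul_gaugeTransform` — the drift commutes with gauge transformations
  (`e^{icp} · V^h = (e^{icp} · V)^h`, commutativity of `U(1)`);
* **`u1_fthmc_conjKernel_gaugeTransform`** — for every `h : Λ → U(1)`, every gauge-equivariant
  member `F` with gauge-invariant measurable booked density `J`, every gauge-invariant measurable
  `S`, every `c`, `n`, and every measurable force routine that is gauge INVARIANT
  (`g (V^h) = g V`), the engine's `U(1)` FT-HMC configuration kernel commutes with
  `Θ_h = Elitzur.gaugeTransformMEquiv h`;
* **`u1ExactForce_gaugeTransform`** — the EXACT force `g_κ V (e) = κ · fderiv ℝ (p ↦ S̃(e^{icp} · V)) 0 (e_e)`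
  of ANY gauge-invariant `S̃` is gauge invariant (no chain rule needed: the two functions of `p`
  coincide); `measurable_u1ExactForce` (continuous `S̃`, `measurable_fderiv_apply_const_with_param`);
  **`u1_fthmc_exactForce_conjKernel_gaugeTransform`** — with the exact-gradient force of
  `S̃ = S∘F − log J` (continuous) NO hypothesis on the force is left;
* members as packaged: `u1_fthmc_conjKernel_gaugeTransform_layers` (any layer list with
  equivariant composite and invariant running log-det — the LO member by
  `u1WilsonFlowLO_member_gauge`), **`u1_fthmc_wilsonFlowLO_gaugeCovariant`** — the engine's `U(1)`
  LO Wilson-flow member for ANY schedule of masked sub-steps (proper colouring, `2(d−1)|ε| < 1`),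
  formulas verbatim as in `exists_layers_u1WilsonFlowLO`.

NOT CLAIMED: floating point; the learned `U(1)` members' covariance (their conditioners are not
typed as invariant); any number.
-/

noncomputable section

namespace Summit.Ventures.LatticeQCDFlow.Exactness

open Set MeasureTheory
open ProbabilityTheory ProbabilityTheory.Kernel
open Literature.MathematicalPhysics.QuantumFieldTheory Literature.Barriers.QuantumFields
open scoped ENNReal

variable {d L : ℕ}

/-! ## The drift commutes with gauge transformations -/

/-- `e^{icp} · V^h = (e^{icp} · V)^h` — the `U(1)` drift commutes with every gauge transformation
(the group is abelian). -/
theorem circleDrift_mul_gaugeTransform (h : Site d L → Circle) (c : ℝ) (p : (Edge d L → ℝ)) (V : GaugeConfig d L Circle) :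
    (fun i : Edge d L => Circle.exp (c * p i)) * gaugeTransform h V = gaugeTransform h ((fun i : Edge d L => Circle.exp (c * p i)) * V) := by
  funext e
  change Circle.exp (c * p e) * (h e.1 * V e * (h (e.1.shift e.2))⁻¹) =
    h e.1 * (Circle.exp (c * p e) * V e) * (h (e.1.shift e.2))⁻¹
  simp only [mul_assoc]
  rw [mul_left_comm]

variable [NeZero L]

/-! ## The FT-HMC kernel commutes with gauge transformations (invariant force routine) -/

/-- **The engine's `U(1)` FT-HMC configuration kernel commutes with every gauge transformation.**
Gauge-equivariant member `F`, gauge-invariant measurable booked density `J` and action `S`,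
gauge-INVARIANT measurable force routine `g` (`g (V^h) = g V`), any `c`, `n`:
`conjKernel K Θ_h = K`. -/
theorem u1_fthmc_conjKernel_gaugeTransform (h : Site d L → Circle)
    (F : GaugeConfig d L Circle ≃ᵐ GaugeConfig d L Circle) (hF : IsGaugeEquivariant (⇑F))
    {J : GaugeConfig d L Circle → ℝ} (hJm : Measurable J) (hJ : IsGaugeInvariant J)
    {S : GaugeConfig d L Circle → ℝ} (hS : Measurable S) (hSi : IsGaugeInvariant S) (c : ℝ)
    {g : GaugeConfig d L Circle → (Edge d L → ℝ)} (hg : Measurable g) (hgi : ∀ V : GaugeConfig d L Circle, g (gaugeTransform h V) = g V) (n : ℕ) :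
    conjKernel
      (conjKernel
        (refreshUpdate
          (involMH
            (⇑((flip : Equiv.Perm (GaugeConfig d L Circle × (Edge d L → ℝ))) *
                leapfrog (mulDrift (fun p : Edge d L → ℝ => fun i : Edge d L => Circle.exp (c * p i))) g ^ n))
            (measurable_flip_leapfrog_pow (measurable_mulDrift (measurable_circleDrift c)) hg n)
            fun z : GaugeConfig d L Circle × (Edge d L → ℝ) =>
              (S (F z.1) - Real.log (J z.1)) + ∑ i, z.2 i ^ 2 / 2)
          ((((volume : Measure (Edge d L → ℝ)).withDensity
                  fun p => ENNReal.ofReal (Real.exp (-(∑ i, p i ^ 2 / 2)))) Set.univ)⁻¹ •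
              (volume : Measure (Edge d L → ℝ)).withDensity
                fun p => ENNReal.ofReal (Real.exp (-(∑ i, p i ^ 2 / 2)))))
        F)
      (Elitzur.gaugeTransformMEquiv h) =
      (conjKernel
        (refreshUpdate
          (involMH
            (⇑((flip : Equiv.Perm (GaugeConfig d L Circle × (Edge d L → ℝ))) *
                leapfrog (mulDrift (fun p : Edge d L → ℝ => fun i : Edge d L => Circle.exp (c * p i))) g ^ n))
            (measurable_flip_leapfrog_pow (measurable_mulDrift (measurable_circleDrift c)) hg n)
            fun z : GaugeConfig d L Circle × (Edge d L → ℝ) =>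
              (S (F z.1) - Real.log (J z.1)) + ∑ i, z.2 i ^ 2 / 2)
          ((((volume : Measure (Edge d L → ℝ)).withDensity
                  fun p => ENNReal.ofReal (Real.exp (-(∑ i, p i ^ 2 / 2)))) Set.univ)⁻¹ •
              (volume : Measure (Edge d L → ℝ)).withDensity
                fun p => ENNReal.ofReal (Real.exp (-(∑ i, p i ^ 2 / 2)))))
        F) :=
  gauge_fthmc_conjKernel_eq_self (Q := GaugeConfig d L Circle) (P := (Edge d L → ℝ)) (ν := (volume : Measure (Edge d L → ℝ)))
    (e := (fun p : Edge d L → ℝ => fun i : Edge d L => Circle.exp (c * p i))) (g := g) (S := S) (T := fun p : (Edge d L → ℝ) => ∑ i, p i ^ 2 / 2) (J := J)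
    (measurable_circleDrift c) hg n hS measurable_piGaussianKinetic F hJm (Elitzur.gaugeTransformMEquiv h)
    (MeasurableEquiv.refl (Edge d L → ℝ)) (fun _ => rfl) (fun _ _ => rfl)
    (fun p V => circleDrift_mul_gaugeTransform h c p V) hgi (fun V => hF h V) (fun V => hSi h V)
    (fun V => hJ h V) (fun _ => rfl) (MeasurePreserving.id _)

/-! ## The exact force of an invariant action is invariant -/

omit [NeZero L] in
/-- **The exact force of a gauge-invariant action is gauge invariant on the `U(1)` rung**:
`g_κ (V^h) = g_κ V` for `g_κ V (e) = κ · fderiv ℝ (p ↦ S̃(e^{icp} · V)) 0 (Pi.single e 1)` — the two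
functions of `p` coincide (`circleDrift_mul_gaugeTransform` and invariance of `S̃`). -/
theorem u1ExactForce_gaugeTransform (h : Site d L → Circle) {St : GaugeConfig d L Circle → ℝ} (hSt : IsGaugeInvariant St)
    (c κ : ℝ) (V : GaugeConfig d L Circle) :
    (fun i : Edge d L => κ * fderiv ℝ (fun p : (Edge d L → ℝ) => St ((fun i : Edge d L => Circle.exp (c * p i)) * gaugeTransform h V)) 0 (Pi.single i 1)) =
      (fun i : Edge d L => κ * fderiv ℝ (fun p : (Edge d L → ℝ) => St ((fun i : Edge d L => Circle.exp (c * p i)) * V)) 0 (Pi.single i 1)) := by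
  have hfun : (fun p : (Edge d L → ℝ) => St ((fun i : Edge d L => Circle.exp (c * p i)) * gaugeTransform h V)) =
      (fun p : (Edge d L → ℝ) => St ((fun i : Edge d L => Circle.exp (c * p i)) * V)) := by
    funext p
    rw [circleDrift_mul_gaugeTransform h c p V, hSt h]
  funext i
  rw [hfun]

/-- The exact force routine is measurable in the field for every continuous action `S̃`. -/
theorem measurable_u1ExactForce {St : GaugeConfig d L Circle → ℝ} (hSt : Continuous St) (c κ : ℝ) :
    Measurable fun V : GaugeConfig d L Circle => (fun i : Edge d L => κ * fderiv ℝ (fun p : (Edge d L → ℝ) => St ((fun i : Edge d L => Circle.exp (c * p i)) * V)) 0 (Pi.single i 1)) := by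
  refine measurable_pi_lambda _ fun i => ?_
  have hdrift : Continuous fun p : (Edge d L → ℝ) => (fun i : Edge d L => Circle.exp (c * p i)) :=
    continuous_pi fun e => Circle.exp.continuous.comp (continuous_const.mul (continuous_apply e))
  have hmul : Continuous fun P : GaugeConfig d L Circle × (Edge d L → ℝ) => (fun i : Edge d L => Circle.exp (c * P.2 i)) * P.1 :=
    (hdrift.comp continuous_snd).mul continuous_fst
  have hf : Continuous (Function.uncurry fun (V : GaugeConfig d L Circle) (p : (Edge d L → ℝ)) => St ((fun i : Edge d L => Circle.exp (c * p i)) * V)) := by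
    change Continuous fun P : GaugeConfig d L Circle × (Edge d L → ℝ) => St ((fun i : Edge d L => Circle.exp (c * P.2 i)) * P.1)
    exact hSt.comp hmul
  have hm : Measurable fun P : GaugeConfig d L Circle × (Edge d L → ℝ) =>
      fderiv ℝ (fun p : (Edge d L → ℝ) => St ((fun i : Edge d L => Circle.exp (c * p i)) * P.1)) P.2 (Pi.single i 1) :=
    measurable_fderiv_apply_const_with_param ℝ hf (Pi.single i 1)
  have hk : Measurable fun V : GaugeConfig d L Circle => (V, (0 : (Edge d L → ℝ))) := measurable_id.prodMk measurable_const
  have h5 := hm.comp hk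
  have h6 : Measurable fun V : GaugeConfig d L Circle =>
      fderiv ℝ (fun p : (Edge d L → ℝ) => St ((fun i : Edge d L => Circle.exp (c * p i)) * V)) 0 (Pi.single i 1) := by
    exact h5
  exact h6.const_mul κ

/-- **`U(1)` FT-HMC with the exact-gradient force of the pulled-back action commutes with every
gauge transformation — no hypothesis on the force left.**  Equivariant `F`, invariant measurable
`J`, `S`, continuous `S̃ = S∘F − log J`, any `c`, `κ`, `n`, `h`. -/
theorem u1_fthmc_exactForce_conjKernel_gaugeTransform (h : Site d L → Circle)
    (F : GaugeConfig d L Circle ≃ᵐ GaugeConfig d L Circle) (hF : IsGaugeEquivariant (⇑F))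
    {J : GaugeConfig d L Circle → ℝ} (hJm : Measurable J) (hJ : IsGaugeInvariant J)
    {S : GaugeConfig d L Circle → ℝ} (hS : Measurable S) (hSi : IsGaugeInvariant S)
    (hSc : Continuous fun W : GaugeConfig d L Circle => S (F W) - Real.log (J W)) (c κ : ℝ) (n : ℕ) :
    conjKernel
      (conjKernel
        (refreshUpdate
          (involMH
            (⇑((flip : Equiv.Perm (GaugeConfig d L Circle × (Edge d L → ℝ))) *
                leapfrog (mulDrift (fun p : Edge d L → ℝ => fun i : Edge d L => Circle.exp (c * p i))) (fun V : GaugeConfig d L Circle => (fun i : Edge d L => κ * fderiv ℝ (fun p : (Edge d L → ℝ) => (fun W : GaugeConfig d L Circle => S (F W) - Real.log (J W)) ((fun i : Edge d L => Circle.exp (c * p i)) * V)) 0 (Pi.single i 1))) ^ n))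
            (measurable_flip_leapfrog_pow (measurable_mulDrift (measurable_circleDrift c)) (measurable_u1ExactForce hSc c κ) n)
            fun z : GaugeConfig d L Circle × (Edge d L → ℝ) =>
              (S (F z.1) - Real.log (J z.1)) + ∑ i, z.2 i ^ 2 / 2)
          ((((volume : Measure (Edge d L → ℝ)).withDensity
                  fun p => ENNReal.ofReal (Real.exp (-(∑ i, p i ^ 2 / 2)))) Set.univ)⁻¹ •
              (volume : Measure (Edge d L → ℝ)).withDensity
                fun p => ENNReal.ofReal (Real.exp (-(∑ i, p i ^ 2 / 2)))))
        F)
      (Elitzur.gaugeTransformMEquiv h) =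
      (conjKernel
        (refreshUpdate
          (involMH
            (⇑((flip : Equiv.Perm (GaugeConfig d L Circle × (Edge d L → ℝ))) *
                leapfrog (mulDrift (fun p : Edge d L → ℝ => fun i : Edge d L => Circle.exp (c * p i))) (fun V : GaugeConfig d L Circle => (fun i : Edge d L => κ * fderiv ℝ (fun p : (Edge d L → ℝ) => (fun W : GaugeConfig d L Circle => S (F W) - Real.log (J W)) ((fun i : Edge d L => Circle.exp (c * p i)) * V)) 0 (Pi.single i 1))) ^ n))
            (measurable_flip_leapfrog_pow (measurable_mulDrift (measurable_circleDrift c)) (measurable_u1ExactForce hSc c κ) n)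
            fun z : GaugeConfig d L Circle × (Edge d L → ℝ) =>
              (S (F z.1) - Real.log (J z.1)) + ∑ i, z.2 i ^ 2 / 2)
          ((((volume : Measure (Edge d L → ℝ)).withDensity
                  fun p => ENNReal.ofReal (Real.exp (-(∑ i, p i ^ 2 / 2)))) Set.univ)⁻¹ •
              (volume : Measure (Edge d L → ℝ)).withDensity
                fun p => ENNReal.ofReal (Real.exp (-(∑ i, p i ^ 2 / 2)))))
        F) :=
  u1_fthmc_conjKernel_gaugeTransform h F hF hJm hJ hS hSi c (measurable_u1ExactForce hSc c κ)
    (fun V => u1ExactForce_gaugeTransform h (isGaugeInvariant_ftAction hSi hF hJ) c κ V) n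

/-! ## Members as the engine packages them -/

/-- **Schedules of layers**: any list of layers whose composite is gauge equivariant with
gauge-invariant running log-det and measurable densities (the LO member by
`u1WilsonFlowLO_member_gauge`); invariant measurable `S`, invariant measurable force, any `c`, `n`. -/
theorem u1_fthmc_conjKernel_gaugeTransform_layers (h : Site d L → Circle)
    (layers : List ((GaugeConfig d L Circle ≃ᵐ GaugeConfig d L Circle) × (GaugeConfig d L Circle → ℝ)))
    (hmeas : ∀ Ly ∈ layers, Measurable Ly.2)
    (hFeq : IsGaugeEquivariant (⇑(layers.foldr (fun Ly (G : GaugeConfig d L Circle ≃ᵐ GaugeConfig d L Circle) => Ly.1.trans G)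
              (MeasurableEquiv.refl (GaugeConfig d L Circle)))))
    (hJinv : IsGaugeInvariant (layers.foldr (fun Ly K => fun V => Ly.2 V * K (Ly.1 V)) (fun _ => (1 : ℝ))))
    {S : GaugeConfig d L Circle → ℝ} (hS : Measurable S) (hSi : IsGaugeInvariant S) (c : ℝ)
    {g : GaugeConfig d L Circle → (Edge d L → ℝ)} (hg : Measurable g) (hgi : ∀ V : GaugeConfig d L Circle, g (gaugeTransform h V) = g V) (n : ℕ) :
    conjKernel
      (conjKernel
        (refreshUpdate
          (involMH
            (⇑((flip : Equiv.Perm (GaugeConfig d L Circle × (Edge d L → ℝ))) *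
                leapfrog (mulDrift (fun p : Edge d L → ℝ => fun i : Edge d L => Circle.exp (c * p i))) g ^ n))
            (measurable_flip_leapfrog_pow (measurable_mulDrift (measurable_circleDrift c)) hg n)
            fun z : GaugeConfig d L Circle × (Edge d L → ℝ) =>
              (S ((layers.foldr (fun Ly (G : GaugeConfig d L Circle ≃ᵐ GaugeConfig d L Circle) => Ly.1.trans G)
              (MeasurableEquiv.refl (GaugeConfig d L Circle))) z.1) - Real.log ((layers.foldr (fun Ly K => fun V => Ly.2 V * K (Ly.1 V)) (fun _ => (1 : ℝ))) z.1)) + ∑ i, z.2 i ^ 2 / 2)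
          ((((volume : Measure (Edge d L → ℝ)).withDensity
                  fun p => ENNReal.ofReal (Real.exp (-(∑ i, p i ^ 2 / 2)))) Set.univ)⁻¹ •
              (volume : Measure (Edge d L → ℝ)).withDensity
                fun p => ENNReal.ofReal (Real.exp (-(∑ i, p i ^ 2 / 2)))))
        (layers.foldr (fun Ly (G : GaugeConfig d L Circle ≃ᵐ GaugeConfig d L Circle) => Ly.1.trans G)
              (MeasurableEquiv.refl (GaugeConfig d L Circle))))
      (Elitzur.gaugeTransformMEquiv h) =
      (conjKernel
        (refreshUpdate
          (involMH
            (⇑((flip : Equiv.Perm (GaugeConfig d L Circle × (Edge d L → ℝ))) *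
                leapfrog (mulDrift (fun p : Edge d L → ℝ => fun i : Edge d L => Circle.exp (c * p i))) g ^ n))
            (measurable_flip_leapfrog_pow (measurable_mulDrift (measurable_circleDrift c)) hg n)
            fun z : GaugeConfig d L Circle × (Edge d L → ℝ) =>
              (S ((layers.foldr (fun Ly (G : GaugeConfig d L Circle ≃ᵐ GaugeConfig d L Circle) => Ly.1.trans G)
              (MeasurableEquiv.refl (GaugeConfig d L Circle))) z.1) - Real.log ((layers.foldr (fun Ly K => fun V => Ly.2 V * K (Ly.1 V)) (fun _ => (1 : ℝ))) z.1)) + ∑ i, z.2 i ^ 2 / 2)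
          ((((volume : Measure (Edge d L → ℝ)).withDensity
                  fun p => ENNReal.ofReal (Real.exp (-(∑ i, p i ^ 2 / 2)))) Set.univ)⁻¹ •
              (volume : Measure (Edge d L → ℝ)).withDensity
                fun p => ENNReal.ofReal (Real.exp (-(∑ i, p i ^ 2 / 2)))))
        (layers.foldr (fun Ly (G : GaugeConfig d L Circle ≃ᵐ GaugeConfig d L Circle) => Ly.1.trans G)
              (MeasurableEquiv.refl (GaugeConfig d L Circle)))) :=
  u1_fthmc_conjKernel_gaugeTransform h _ hFeq (measurable_foldr_logDet layers hmeas) hJinv hS hSi c hg hgi n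

variable {X : Type*} [DecidableEq X] (χ : Site d L → X)

/-- **The engine's `U(1)` LO Wilson-flow member, any schedule of masked sub-steps** (proper
colouring `χ`, refusal rule `2(d−1)|ε| < 1`; formulas verbatim as in `exists_layers_u1WilsonFlowLO`):
the FT-HMC kernel through it commutes with EVERY gauge transformation, for every gauge-invariant
measurable action, invariant measurable force routine, `c`, `n`. -/
theorem u1_fthmc_wilsonFlowLO_gaugeCovariant
    (hχ : ∀ (x : Site d L) (i : Fin d), χ (x.shift i) ≠ χ x) {ε : ℝ}
    (hε : |ε| * (2 * ((d - 1 : ℕ) : ℝ)) < 1) (sched : List (Fin d × X)) :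
    ∃ layers : List ((GaugeConfig d L Circle ≃ᵐ GaugeConfig d L Circle) × (GaugeConfig d L Circle → ℝ)),
      layers.map (fun Ly => ((Ly.1 : GaugeConfig d L Circle → GaugeConfig d L Circle), Ly.2)) = sched.map (fun s =>
        ((fun (V : GaugeConfig d L Circle) (e : Edge d L) => if e.2 = s.1 ∧ χ e.1 = s.2 then
          V e * Circle.exp (ε * ∑ ν ∈ Finset.univ.erase e.2,
            (((plaquetteHolonomy V (e.1 - Pi.single ν 1) e.2 ν : Circle) : ℂ).im -
              ((plaquetteHolonomy V e.1 e.2 ν : Circle) : ℂ).im)) else V e),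
         fun V : GaugeConfig d L Circle => ∏ a : {e : Edge d L // e.2 = s.1 ∧ χ e.1 = s.2},
          (1 - ε * ∑ ν ∈ Finset.univ.erase a.1.2,
            (((plaquetteHolonomy V a.1.1 a.1.2 ν : Circle) : ℂ).re +
              ((plaquetteHolonomy V (a.1.1 - Pi.single ν 1) a.1.2 ν : Circle) : ℂ).re)))) ∧
      ∀ (h : Site d L → Circle) {S : GaugeConfig d L Circle → ℝ} (hS : Measurable S) (_hSi : IsGaugeInvariant S) (c : ℝ)
        {g : GaugeConfig d L Circle → (Edge d L → ℝ)} (hg : Measurable g) (_hgi : ∀ V : GaugeConfig d L Circle, g (gaugeTransform h V) = g V) (n : ℕ),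
      conjKernel
        (conjKernel
          (refreshUpdate
            (involMH
              (⇑((flip : Equiv.Perm (GaugeConfig d L Circle × (Edge d L → ℝ))) *
                  leapfrog (mulDrift (fun p : Edge d L → ℝ => fun i : Edge d L => Circle.exp (c * p i))) g ^ n))
              (measurable_flip_leapfrog_pow (measurable_mulDrift (measurable_circleDrift c)) hg n)
              fun z : GaugeConfig d L Circle × (Edge d L → ℝ) =>
                (S ((layers.foldr (fun Ly (G : GaugeConfig d L Circle ≃ᵐ GaugeConfig d L Circle) => Ly.1.trans G)
              (MeasurableEquiv.refl (GaugeConfig d L Circle))) z.1) - Real.log ((layers.foldr (fun Ly K => fun V => Ly.2 V * K (Ly.1 V)) (fun _ => (1 : ℝ))) z.1)) + ∑ i, z.2 i ^ 2 / 2)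
            ((((volume : Measure (Edge d L → ℝ)).withDensity
                  fun p => ENNReal.ofReal (Real.exp (-(∑ i, p i ^ 2 / 2)))) Set.univ)⁻¹ •
              (volume : Measure (Edge d L → ℝ)).withDensity
                fun p => ENNReal.ofReal (Real.exp (-(∑ i, p i ^ 2 / 2)))))
          (layers.foldr (fun Ly (G : GaugeConfig d L Circle ≃ᵐ GaugeConfig d L Circle) => Ly.1.trans G)
              (MeasurableEquiv.refl (GaugeConfig d L Circle))))
        (Elitzur.gaugeTransformMEquiv h) =
        (conjKernel
          (refreshUpdate
            (involMH
              (⇑((flip : Equiv.Perm (GaugeConfig d L Circle × (Edge d L → ℝ))) *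
                  leapfrog (mulDrift (fun p : Edge d L → ℝ => fun i : Edge d L => Circle.exp (c * p i))) g ^ n))
              (measurable_flip_leapfrog_pow (measurable_mulDrift (measurable_circleDrift c)) hg n)
              fun z : GaugeConfig d L Circle × (Edge d L → ℝ) =>
                (S ((layers.foldr (fun Ly (G : GaugeConfig d L Circle ≃ᵐ GaugeConfig d L Circle) => Ly.1.trans G)
              (MeasurableEquiv.refl (GaugeConfig d L Circle))) z.1) - Real.log ((layers.foldr (fun Ly K => fun V => Ly.2 V * K (Ly.1 V)) (fun _ => (1 : ℝ))) z.1)) + ∑ i, z.2 i ^ 2 / 2)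
            ((((volume : Measure (Edge d L → ℝ)).withDensity
                  fun p => ENNReal.ofReal (Real.exp (-(∑ i, p i ^ 2 / 2)))) Set.univ)⁻¹ •
              (volume : Measure (Edge d L → ℝ)).withDensity
                fun p => ENNReal.ofReal (Real.exp (-(∑ i, p i ^ 2 / 2)))))
          (layers.foldr (fun Ly (G : GaugeConfig d L Circle ≃ᵐ GaugeConfig d L Circle) => Ly.1.trans G)
              (MeasurableEquiv.refl (GaugeConfig d L Circle)))) := by
  obtain ⟨layers, hmap, -, hmeas, -⟩ := exists_layers_u1WilsonFlowLO χ hχ hε sched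
  have hgauge := u1WilsonFlowLO_member_gauge χ ε sched layers hmap
  refine ⟨layers, hmap, ?_⟩
  intro h S hS hSi c g hg hgi n
  exact u1_fthmc_conjKernel_gaugeTransform_layers h layers hmeas hgauge.1 hgauge.2 hS hSi c hg hgi n

end Summit.Ventures.LatticeQCDFlow.Exactness
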